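import Summits.BirchSwinnertonDyer.BirchSwinnertonDyer.Theorems.SignedLowerHalvesSmallImageLowerHalfBothSignsLambdaLowerThreeNsThetaPartnerLevelMatchAlgebra
import Literature.NumberTheory.GaloisRepresentations.ArtinConductor
import HarnessLib

/-!
# The fixed space of an inertia-type subgroup with trivial determinant is `0` or everything (brick LM-B of
# `stub_levelMatch_ns`)

Route `SignedLowerHalves`, child L `SmallImageLowerHalfBothSigns` (item stmt-BirchSwinnertonDyer-23599), line `rtt_w3`
(v2 proposal `Lines/rtt_w3_v2.lean`, stub `stub_levelMatch_ns`; width seat `bsd-line-slh-p3-w3` gen 10; memo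
`Lines/birth_acns-MEMO-w3-g10.md` §4).  THEOREMS ONLY (no definition, no named fact, no `sorry`); ROUTE-INDEPENDENT.

For a rank-`2` framed representation `ρ : G →ₜ* GL₂(A)` over a field `A` and a subgroup `H ≤ G` on which `det ρ = 1`
and `ρ(h)^N = 1` with `(N : A) ≠ 0` (a finite image of exponent prime to the characteristic — the wild inertia, or any
ramification group `Γ^u`, `u > 0`, at a prime `ℓ ≠ char A` where the determinant is cyclotomic, hence unramified):

* `FramedRep.toContinuousRep_eq_one_of_mem_fixedSubmodule` — a non-zero `H`-fixed vector forces `H` to act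
  trivially (brick LM-A `LinearMap.eq_one_of_apply_eq_of_det_eq_one_of_pow_eq_one`);
* `FramedRep.fixedSubmodule_eq_bot_or_eq_top`, `FramedRep.codimFixed_eq_two_or_eq_zero` — so the fixed space is
  `⊥` or `⊤` and the codimension entering the Artin/Swan conductor (`ContinuousRep.codimFixed`) is `2` or `0`.

This is input (d) of the level clause (memo §4): at `ℓ ≠ p` the conductor exponents of `ρ_g` and of `V_p(W)` are
either both `2 + sw_ℓ` or both tame `≤ 2`.  BSD, crux L and the stub are NOT proved here.

References: J.-P. Serre, Corps locaux VI §2; Serre–Tate 1968 §3; folklore.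
-/

set_option autoImplicit false
set_option linter.dupNamespace false

noncomputable section

open scoped MatrixGroups
open Module Matrix

namespace Summit.BirchSwinnertonDyer.BirchSwinnertonDyer.Theorems.SmallImageLambdaLowerThreeNsThetaPartner

open Literature.NumberTheory.GaloisRepresentations

variable {G : Type*} [Group G] [TopologicalSpace G] {A : Type*} [Field A] [TopologicalSpace A] [IsTopologicalRing A]

omit [IsTopologicalRing A] in
/-- **DICHOTOMY, linear form.**  For a continuous representation `ρ` of `G` on a `2`-dimensional `A`-vector space and
a subgroup `H` on which every `ρ(h)` has determinant `1` and satisfies `ρ(h)^N = 1` with `(N : A) ≠ 0`: the `H`-fixed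
submodule is `⊥` or `⊤` (brick LM-A applied to a non-zero fixed vector). [folklore] -/
theorem ContinuousRep.fixedSubmodule_eq_bot_or_eq_top_of_det_eq_one {M : Type*} [AddCommGroup M] [Module A M]
    [TopologicalSpace M] (ρ : ContinuousRep G A M) (h2 : finrank A M = 2) (H : Subgroup G) {N : ℕ} (hN : (N : A) ≠ 0)
    (hpow : ∀ h ∈ H, (ρ h : M →ₗ[A] M) ^ N = 1) (hdet : ∀ h ∈ H, LinearMap.det (ρ h : M →ₗ[A] M) = 1) :
    ρ.fixedSubmodule H = ⊥ ∨ ρ.fixedSubmodule H = ⊤ := by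
  by_cases hbot : ρ.fixedSubmodule H = ⊥
  · exact Or.inl hbot
  · right
    obtain ⟨v, hvmem, hv⟩ := (Submodule.ne_bot_iff _).mp hbot
    refine ρ.fixedSubmodule_eq_top_of_forall_eq_one fun h hh => ?_
    exact LinearMap.eq_one_of_apply_eq_of_det_eq_one_of_pow_eq_one h2 _ hv
      ((ρ.mem_fixedSubmodule H v).mp hvmem h hh) (hdet h hh) hN (hpow h hh)

/-- The linear map of a framed representation at `g` is `Matrix.toLinAlgEquiv'` of the matrix `ρ g`. [folklore] -/
theorem FramedRep.toContinuousRep_apply_eq_toLinAlgEquiv' {n : ℕ} (ρ : FramedRep G A n) (g : G) :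
    (ρ.toContinuousRep g : (Fin n → A) →ₗ[A] (Fin n → A)) =
      Matrix.toLinAlgEquiv' ((ρ g : GL (Fin n) A) : Matrix (Fin n) (Fin n) A) := by
  refine LinearMap.ext fun v => ?_
  rw [FramedRep.toContinuousRep_apply_apply, Matrix.toLinAlgEquiv'_apply]

/-- **A non-zero fixed vector forces triviality** (rank `2`, `det = 1`, exponent prime to the characteristic): if
`v ≠ 0` is fixed by every `h ∈ H`, `det ρ(h) = 1` and `ρ(h)^N = 1` on `H` with `(N : A) ≠ 0`, then `ρ(h)` acts as the
identity for every `h ∈ H`. [folklore] -/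
theorem FramedRep.toContinuousRep_eq_one_of_mem_fixedSubmodule (ρ : FramedRep G A 2) (H : Subgroup G) {N : ℕ}
    (hN : (N : A) ≠ 0) (hpow : ∀ h ∈ H, ρ h ^ N = 1)
    (hdet : ∀ h ∈ H, Matrix.GeneralLinearGroup.det (ρ h) = 1) {v : Fin 2 → A} (hv : v ≠ 0)
    (hfix : v ∈ ρ.toContinuousRep.fixedSubmodule H) :
    ∀ h ∈ H, (ρ.toContinuousRep h : (Fin 2 → A) →ₗ[A] (Fin 2 → A)) = 1 := by
  intro h hh
  have h2 : finrank A (Fin 2 → A) = 2 := by simp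
  have hfixh : ρ.toContinuousRep h v = v := (ρ.toContinuousRep.mem_fixedSubmodule H v).mp hfix h hh
  have hdeth : LinearMap.det (ρ.toContinuousRep h : (Fin 2 → A) →ₗ[A] (Fin 2 → A)) = 1 := by
    rw [FramedRep.toContinuousRep_apply_eq_toLinAlgEquiv']
    have hd : LinearMap.det (Matrix.toLinAlgEquiv' ((ρ h : GL (Fin 2) A) : Matrix (Fin 2) (Fin 2) A)) =
        ((ρ h : GL (Fin 2) A) : Matrix (Fin 2) (Fin 2) A).det := LinearMap.det_toLin' _
    rw [hd, ← Matrix.GeneralLinearGroup.val_det_apply, hdet h hh, Units.val_one]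
  have hpowh : (ρ.toContinuousRep h : (Fin 2 → A) →ₗ[A] (Fin 2 → A)) ^ N = 1 := by
    rw [FramedRep.toContinuousRep_apply_eq_toLinAlgEquiv', ← map_pow, ← Units.val_pow_eq_pow_val, hpow h hh,
      Units.val_one, map_one]
  exact LinearMap.eq_one_of_apply_eq_of_det_eq_one_of_pow_eq_one h2 _ hv hfixh hdeth hN hpowh

/-- **DICHOTOMY for the fixed space.**  Under the same hypotheses, the `H`-fixed submodule of `A²` is `⊥` or `⊤`.
[folklore] -/
theorem FramedRep.fixedSubmodule_eq_bot_or_eq_top (ρ : FramedRep G A 2) (H : Subgroup G) {N : ℕ} (hN : (N : A) ≠ 0)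
    (hpow : ∀ h ∈ H, ρ h ^ N = 1) (hdet : ∀ h ∈ H, Matrix.GeneralLinearGroup.det (ρ h) = 1) :
    ρ.toContinuousRep.fixedSubmodule H = ⊥ ∨ ρ.toContinuousRep.fixedSubmodule H = ⊤ := by
  by_cases hbot : ρ.toContinuousRep.fixedSubmodule H = ⊥
  · exact Or.inl hbot
  · right
    obtain ⟨v, hvmem, hv⟩ := (Submodule.ne_bot_iff _).mp hbot
    refine ρ.toContinuousRep.fixedSubmodule_eq_top_of_forall_eq_one fun h hh => ?_
    exact FramedRep.toContinuousRep_eq_one_of_mem_fixedSubmodule ρ H hN hpow hdet hv hvmem h hh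

/-- **The codimension entering the conductor is `2` or `0`.**  Under the same hypotheses,
`codim (A²)^H ∈ {2, 0}` (`ContinuousRep.codimFixed`). [folklore] -/
theorem FramedRep.codimFixed_eq_two_or_eq_zero (ρ : FramedRep G A 2) (H : Subgroup G) {N : ℕ} (hN : (N : A) ≠ 0)
    (hpow : ∀ h ∈ H, ρ h ^ N = 1) (hdet : ∀ h ∈ H, Matrix.GeneralLinearGroup.det (ρ h) = 1) :
    ρ.toContinuousRep.codimFixed H = 2 ∨ ρ.toContinuousRep.codimFixed H = 0 := by
  rcases FramedRep.fixedSubmodule_eq_bot_or_eq_top ρ H hN hpow hdet with h | h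
  · left
    rw [ContinuousRep.codimFixed, h, (Submodule.quotEquivOfEqBot _ rfl).finrank_eq]
    simp
  · right
    rw [ContinuousRep.codimFixed, h]
    haveI : Subsingleton ((Fin 2 → A) ⧸ (⊤ : Submodule A (Fin 2 → A))) :=
      Submodule.Quotient.subsingleton_iff.mpr rfl
    exact finrank_zero_of_subsingleton

end Summit.BirchSwinnertonDyer.BirchSwinnertonDyer.Theorems.SmallImageLambdaLowerThreeNsThetaPartner

end
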